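import Summits.AtomisticToContinuum.Crystallization.Theorems.ExcessDecayLiouvilleHcpLiouvilleBlowdownDefs
import Summits.AtomisticToContinuum.Crystallization.Theorems.ExcessDecayLiouvilleDirichletSolve
import Summits.AtomisticToContinuum.Crystallization.Theorems.ExcessDecayLiouvilleHcpLiouvilleSiteSums

/-!
# `ExcessDecayLiouville.HcpLiouville` (stmt-AtomisticToContinuum-9332), line `Sketch` v4: Galerkin solutions, I

Helper file for sub-goal `blowdown_greenSolve` (H2 of stub `stub_green`) of crux stmt-AtomisticToContinuum-9332
(`Summit.AtomisticToContinuum.Crystallization.Theses.ExcessDecayLiouville.HcpLiouville`), line `Sketch`, skeleton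
v4.  The force-constant operator of the sites `S` of an admissible hcp-like datum, written with the continuous linear
map `forceConst` (`(L u)(p) = Σ'_{q ∈ S} K(p − q)(u p − u q)`), is bridged to the explicit-formula operator of the
sister files (`forceConst_sub_apply_eq_ite`), the harmonic-stability inequality `Blowdown.PSIneq κ` is turned into
the coercivity schema of `ExcessDecayLiouvilleDirichletSolve` (`coercive_of_psIneq`), and the FINITE-LEVEL
(Galerkin / Dirichlet) problem on a finite set `V` of sites — `u` supported on `V` with `(L u)(p) = f p` for
`p ∈ V` — is solved (`exists_galerkin`), shown unique (`galerkin_unique`) and linear in `f`.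
All `[folklore]`; a `--supports` helper, nothing here closes an item.
-/

noncomputable section

namespace Summit.AtomisticToContinuum.Crystallization.Theorems.ExcessDecayLiouville

open scoped BigOperators Topology Classical InnerProductSpace RealInnerProductSpace
open Literature.MathematicalPhysics.StatisticalMechanics
open Summit.AtomisticToContinuum.Crystallization.Theses.ExcessDecayLiouville
open Summit.AtomisticToContinuum.Crystallization.Theorems.PhononStabilityNegative

section

variable {t : Fin 2 → EuclideanSpace ℝ (Fin 3)} {A : EuclideanSpace ℝ (Fin 3) →L[ℝ] EuclideanSpace ℝ (Fin 3)}

/-! ## The operator row in `forceConst` form versus the explicit formula -/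

/-- One term of the operator row: `K(p − q)(u p − u q)` equals the guarded explicit formula of the sister files
(at `p = q` both vanish). [folklore] -/
theorem forceConst_sub_apply_eq_ite (u : EuclideanSpace ℝ (Fin 3) → EuclideanSpace ℝ (Fin 3)) (p q : Sites₀ t A) :
    forceConst ((p : EuclideanSpace ℝ (Fin 3)) - q) (u p - u q) =
      (if (p : EuclideanSpace ℝ (Fin 3)) ≠ q then
        ((-((‖(p : EuclideanSpace ℝ (Fin 3)) - q‖ ^ 2)⁻¹) ^ 7 + ((‖(p : EuclideanSpace ℝ (Fin 3)) - q‖ ^ 2)⁻¹) ^ 4) •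
            (u p - u q) +
          (2 * ⟪(p : EuclideanSpace ℝ (Fin 3)) - q, u p - u q⟫ *
            (7 * ((‖(p : EuclideanSpace ℝ (Fin 3)) - q‖ ^ 2)⁻¹) ^ 8 - 4 * ((‖(p : EuclideanSpace ℝ (Fin 3)) - q‖ ^ 2)⁻¹) ^ 5)) •
            ((p : EuclideanSpace ℝ (Fin 3)) - q))
      else 0) := by
  by_cases hpq : (p : EuclideanSpace ℝ (Fin 3)) = q
  · have hpq' : p = q := Subtype.ext hpq
    subst hpq'
    simp
  · rw [if_pos hpq, forceConst_apply]

/-- The operator row is summable for a finitely supported field. [folklore] -/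
theorem summable_forceConst_row (hA : Adm₀ A) (hI : Inner₀ t A)
    {u : EuclideanSpace ℝ (Fin 3) → EuclideanSpace ℝ (Fin 3)} (hu : (Function.support u).Finite) (p : Sites₀ t A) :
    Summable (fun q : Sites₀ t A => forceConst ((p : EuclideanSpace ℝ (Fin 3)) - q) (u p - u q)) := by
  have h := summable_opRow hA hI hu p
  refine h.congr fun q => ?_
  exact (forceConst_sub_apply_eq_ite u p q).symm

/-- The operator row in `forceConst` form equals the explicit-formula row. [folklore] -/
theorem tsum_forceConst_row_eq (u : EuclideanSpace ℝ (Fin 3) → EuclideanSpace ℝ (Fin 3)) (p : Sites₀ t A) :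
    ∑' q : Sites₀ t A, forceConst ((p : EuclideanSpace ℝ (Fin 3)) - q) (u p - u q) =
      ∑' q : Sites₀ t A, (if (p : EuclideanSpace ℝ (Fin 3)) ≠ q then
        ((-((‖(p : EuclideanSpace ℝ (Fin 3)) - q‖ ^ 2)⁻¹) ^ 7 + ((‖(p : EuclideanSpace ℝ (Fin 3)) - q‖ ^ 2)⁻¹) ^ 4) •
            (u p - u q) +
          (2 * ⟪(p : EuclideanSpace ℝ (Fin 3)) - q, u p - u q⟫ *
            (7 * ((‖(p : EuclideanSpace ℝ (Fin 3)) - q‖ ^ 2)⁻¹) ^ 8 - 4 * ((‖(p : EuclideanSpace ℝ (Fin 3)) - q‖ ^ 2)⁻¹) ^ 5)) •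
            ((p : EuclideanSpace ℝ (Fin 3)) - q))
      else 0) :=
  tsum_congr fun q => forceConst_sub_apply_eq_ite u p q

/-- The row family has `HasSum` its `tsum` (finitely supported field). [folklore] -/
theorem hasSum_forceConst_row (hA : Adm₀ A) (hI : Inner₀ t A)
    {u : EuclideanSpace ℝ (Fin 3) → EuclideanSpace ℝ (Fin 3)} (hu : (Function.support u).Finite) (p : Sites₀ t A) :
    HasSum (fun q : Sites₀ t A => forceConst ((p : EuclideanSpace ℝ (Fin 3)) - q) (u p - u q))
      (∑' q : Sites₀ t A, forceConst ((p : EuclideanSpace ℝ (Fin 3)) - q) (u p - u q)) :=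
  (summable_forceConst_row hA hI hu p).hasSum

/-! ## Coercivity from the harmonic-stability inequality -/

/-- **`PSIneq κ` is coercivity of the operator** (the schema `hκ` of `ExcessDecayLiouvilleDirichletSolve`):
`κ · nnForm v ≤ Σ'_p ⟪(L v)(p), v p⟫` for finitely supported `v` on the sites, by `energy_identity`. [folklore] -/
theorem coercive_of_psIneq (hA : Adm₀ A) (hI : Inner₀ t A) {κ : ℝ} (hPS : Blowdown.PSIneq κ t A) :
    ∀ v : EuclideanSpace ℝ (Fin 3) → EuclideanSpace ℝ (Fin 3), (Function.support v).Finite →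
      Function.support v ⊆ Sites₀ t A →
      κ * nnForm t A v ≤ ∑' p : Sites₀ t A, ⟪∑' q : Sites₀ t A, (if (p : EuclideanSpace ℝ (Fin 3)) ≠ q then
        ((-((‖(p : EuclideanSpace ℝ (Fin 3)) - q‖ ^ 2)⁻¹) ^ 7 + ((‖(p : EuclideanSpace ℝ (Fin 3)) - q‖ ^ 2)⁻¹) ^ 4) •
            (v p - v q) +
          (2 * ⟪(p : EuclideanSpace ℝ (Fin 3)) - q, v p - v q⟫ *
            (7 * ((‖(p : EuclideanSpace ℝ (Fin 3)) - q‖ ^ 2)⁻¹) ^ 8 - 4 * ((‖(p : EuclideanSpace ℝ (Fin 3)) - q‖ ^ 2)⁻¹) ^ 5)) •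
            ((p : EuclideanSpace ℝ (Fin 3)) - q))
      else 0), v p⟫ := by
  intro v hv hvS
  rw [energy_identity hA hI hv]
  have h := hPS v hv hvS
  unfold hessForm at h
  linarith

/-- Coercivity in `forceConst` form: `κ · nnForm v ≤ Σ'_p ⟪Σ'_q K(p − q)(v p − v q), v p⟫`. [folklore] -/
theorem coercive_of_psIneq' (hA : Adm₀ A) (hI : Inner₀ t A) {κ : ℝ} (hPS : Blowdown.PSIneq κ t A)
    {v : EuclideanSpace ℝ (Fin 3) → EuclideanSpace ℝ (Fin 3)} (hv : (Function.support v).Finite)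
    (hvS : Function.support v ⊆ Sites₀ t A) :
    κ * nnForm t A v ≤ ∑' p : Sites₀ t A,
      ⟪∑' q : Sites₀ t A, forceConst ((p : EuclideanSpace ℝ (Fin 3)) - q) (v p - v q), v p⟫ := by
  have h := coercive_of_psIneq hA hI hPS v hv hvS
  simpa only [tsum_forceConst_row_eq] using h

/-! ## Linearity of the rows -/

/-- Additivity of the row in the field. [folklore] -/
theorem forceConst_row_add (hA : Adm₀ A) (hI : Inner₀ t A)
    {u v : EuclideanSpace ℝ (Fin 3) → EuclideanSpace ℝ (Fin 3)} (hu : (Function.support u).Finite)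
    (hv : (Function.support v).Finite) (p : Sites₀ t A) :
    ∑' q : Sites₀ t A, forceConst ((p : EuclideanSpace ℝ (Fin 3)) - q) ((u p + v p) - (u q + v q)) =
      ∑' q : Sites₀ t A, forceConst ((p : EuclideanSpace ℝ (Fin 3)) - q) (u p - u q) +
        ∑' q : Sites₀ t A, forceConst ((p : EuclideanSpace ℝ (Fin 3)) - q) (v p - v q) := by
  rw [← (summable_forceConst_row hA hI hu p).tsum_add (summable_forceConst_row hA hI hv p)]
  refine tsum_congr fun q => ?_
  rw [← map_add]
  congr 1
  abel

/-- Homogeneity of the row in the field. [folklore] -/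
theorem forceConst_row_smul (c : ℝ) (u : EuclideanSpace ℝ (Fin 3) → EuclideanSpace ℝ (Fin 3)) (p : Sites₀ t A) :
    ∑' q : Sites₀ t A, forceConst ((p : EuclideanSpace ℝ (Fin 3)) - q) (c • u p - c • u q) =
      c • ∑' q : Sites₀ t A, forceConst ((p : EuclideanSpace ℝ (Fin 3)) - q) (u p - u q) := by
  rw [← tsum_const_smul'' c]
  refine tsum_congr fun q => ?_
  rw [← smul_sub, map_smul]

/-- The row of a difference of finitely supported fields. [folklore] -/
theorem forceConst_row_sub (hA : Adm₀ A) (hI : Inner₀ t A)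
    {u v : EuclideanSpace ℝ (Fin 3) → EuclideanSpace ℝ (Fin 3)} (hu : (Function.support u).Finite)
    (hv : (Function.support v).Finite) (p : Sites₀ t A) :
    ∑' q : Sites₀ t A, forceConst ((p : EuclideanSpace ℝ (Fin 3)) - q) ((u p - v p) - (u q - v q)) =
      ∑' q : Sites₀ t A, forceConst ((p : EuclideanSpace ℝ (Fin 3)) - q) (u p - u q) -
        ∑' q : Sites₀ t A, forceConst ((p : EuclideanSpace ℝ (Fin 3)) - q) (v p - v q) := by
  rw [← (summable_forceConst_row hA hI hu p).tsum_sub (summable_forceConst_row hA hI hv p)]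
  refine tsum_congr fun q => ?_
  rw [← map_sub]
  congr 1
  abel

/-! ## Finite-level (Galerkin) solutions on a finite set of sites -/

/-- A field supported on (the image of) a finite set of sites is finitely supported. [folklore] -/
theorem finite_support_of_subset_image {V : Finset (Sites₀ t A)}
    {u : EuclideanSpace ℝ (Fin 3) → EuclideanSpace ℝ (Fin 3)}
    (hu : Function.support u ⊆ Subtype.val '' (V : Set (Sites₀ t A))) : (Function.support u).Finite :=
  (V.finite_toSet.image _).subset hu

/-- A field supported on a finite set of sites is supported on the sites. [folklore] -/
theorem support_subset_sites_of_subset_image {V : Finset (Sites₀ t A)}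
    {u : EuclideanSpace ℝ (Fin 3) → EuclideanSpace ℝ (Fin 3)}
    (hu : Function.support u ⊆ Subtype.val '' (V : Set (Sites₀ t A))) : Function.support u ⊆ Sites₀ t A := by
  intro x hx
  obtain ⟨y, -, rfl⟩ := hu hx
  exact y.2

/-- A field supported on a finite set `V` of sites vanishes at the sites outside `V`. [folklore] -/
theorem eq_zero_of_not_mem_of_subset_image {V : Finset (Sites₀ t A)}
    {u : EuclideanSpace ℝ (Fin 3) → EuclideanSpace ℝ (Fin 3)}
    (hu : Function.support u ⊆ Subtype.val '' (V : Set (Sites₀ t A))) {q : Sites₀ t A} (hq : q ∉ V) : u q = 0 := by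
  by_contra h
  obtain ⟨y, hy, hyq⟩ := hu h
  exact hq (Subtype.ext hyq ▸ hy)

/-- **Existence of the Galerkin solution** on a finite set `V` of sites: a field `u` supported on `V` with
`(L u)(p) = f p` for `p ∈ V` (from `exists_dirichlet_solution`). [folklore] -/
theorem exists_galerkin (hA : Adm₀ A) (hI : Inner₀ t A) {κ : ℝ} (hκ : 0 < κ) (hPS : Blowdown.PSIneq κ t A)
    (V : Finset (Sites₀ t A)) (f : EuclideanSpace ℝ (Fin 3) → EuclideanSpace ℝ (Fin 3)) :
    ∃ u : EuclideanSpace ℝ (Fin 3) → EuclideanSpace ℝ (Fin 3),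
      Function.support u ⊆ Subtype.val '' (V : Set (Sites₀ t A)) ∧
      ∀ p : Sites₀ t A, p ∈ V →
        ∑' q : Sites₀ t A, forceConst ((p : EuclideanSpace ℝ (Fin 3)) - q) (u p - u q) = f p := by
  set F : Finset (EuclideanSpace ℝ (Fin 3)) := V.map (Function.Embedding.subtype _) with hF
  have hFS : ∀ x ∈ F, x ∈ Sites₀ t A := by
    intro x hx
    simp only [hF, Finset.mem_map, Function.Embedding.coe_subtype] at hx
    obtain ⟨y, -, rfl⟩ := hx
    exact y.2
  obtain ⟨w, hwF, hw⟩ := exists_dirichlet_solution hA hI hκ (coercive_of_psIneq hA hI hPS) hFS f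
  refine ⟨w, ?_, fun p hp => ?_⟩
  · intro x hx
    have := hwF hx
    rw [hF, Finset.coe_map] at this
    simpa using this
  · rw [tsum_forceConst_row_eq]
    refine hw p ?_
    simp only [hF, Finset.mem_map, Function.Embedding.coe_subtype]
    exact ⟨p, hp, rfl⟩

/-- **Uniqueness of the Galerkin solution** on a finite set of sites (from `eq_zero_of_opRow_eq_zero`). [folklore] -/
theorem galerkin_unique (hA : Adm₀ A) (hI : Inner₀ t A) {κ : ℝ} (hκ : 0 < κ) (hPS : Blowdown.PSIneq κ t A)
    {V : Finset (Sites₀ t A)} {f : EuclideanSpace ℝ (Fin 3) → EuclideanSpace ℝ (Fin 3)}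
    {u u' : EuclideanSpace ℝ (Fin 3) → EuclideanSpace ℝ (Fin 3)}
    (hu : Function.support u ⊆ Subtype.val '' (V : Set (Sites₀ t A)))
    (hu' : Function.support u' ⊆ Subtype.val '' (V : Set (Sites₀ t A)))
    (hru : ∀ p : Sites₀ t A, p ∈ V →
      ∑' q : Sites₀ t A, forceConst ((p : EuclideanSpace ℝ (Fin 3)) - q) (u p - u q) = f p)
    (hru' : ∀ p : Sites₀ t A, p ∈ V →
      ∑' q : Sites₀ t A, forceConst ((p : EuclideanSpace ℝ (Fin 3)) - q) (u' p - u' q) = f p) :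
    u = u' := by
  set F : Finset (EuclideanSpace ℝ (Fin 3)) := V.map (Function.Embedding.subtype _) with hF
  have hFS : ∀ x ∈ F, x ∈ Sites₀ t A := by
    intro x hx
    simp only [hF, Finset.mem_map, Function.Embedding.coe_subtype] at hx
    obtain ⟨y, -, rfl⟩ := hx
    exact y.2
  have hcoe : (F : Set (EuclideanSpace ℝ (Fin 3))) = Subtype.val '' (V : Set (Sites₀ t A)) := by
    rw [hF, Finset.coe_map]
    rfl
  set w : EuclideanSpace ℝ (Fin 3) → EuclideanSpace ℝ (Fin 3) := fun x => u x - u' x with hw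
  have hwF : Function.support w ⊆ F := by
    intro x hx
    rw [hcoe]
    by_contra hx'
    have h1 : u x = 0 := by
      by_contra h
      exact hx' (hu h)
    have h2 : u' x = 0 := by
      by_contra h
      exact hx' (hu' h)
    exact hx (by simp [hw, h1, h2])
  have hfu := finite_support_of_subset_image hu
  have hfu' := finite_support_of_subset_image hu'
  have hrow : ∀ p : Sites₀ t A, (p : EuclideanSpace ℝ (Fin 3)) ∈ F →
      ∑' q : Sites₀ t A, (if (p : EuclideanSpace ℝ (Fin 3)) ≠ q then
        ((-((‖(p : EuclideanSpace ℝ (Fin 3)) - q‖ ^ 2)⁻¹) ^ 7 + ((‖(p : EuclideanSpace ℝ (Fin 3)) - q‖ ^ 2)⁻¹) ^ 4) •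
            (w p - w q) +
          (2 * ⟪(p : EuclideanSpace ℝ (Fin 3)) - q, w p - w q⟫ *
            (7 * ((‖(p : EuclideanSpace ℝ (Fin 3)) - q‖ ^ 2)⁻¹) ^ 8 - 4 * ((‖(p : EuclideanSpace ℝ (Fin 3)) - q‖ ^ 2)⁻¹) ^ 5)) •
            ((p : EuclideanSpace ℝ (Fin 3)) - q))
      else 0) = 0 := by
    intro p hp
    have hpV : p ∈ V := by
      simp only [hF, Finset.mem_map, Function.Embedding.coe_subtype] at hp
      obtain ⟨y, hy, hyp⟩ := hp
      exact (Subtype.ext hyp) ▸ hy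
    rw [← tsum_forceConst_row_eq, hw]
    simp only
    rw [forceConst_row_sub hA hI hfu hfu' p, hru p hpV, hru' p hpV, sub_self]
  have hz := eq_zero_of_opRow_eq_zero hA hI hκ (coercive_of_psIneq hA hI hPS) hFS hwF hrow
  funext x
  have := congrFun hz x
  simp only [hw, Pi.zero_apply, sub_eq_zero] at this
  exact this

/-- The Galerkin solution depends only on the values of `f` on `V`. [folklore] -/
theorem galerkin_congr (hA : Adm₀ A) (hI : Inner₀ t A) {κ : ℝ} (hκ : 0 < κ) (hPS : Blowdown.PSIneq κ t A)
    {V : Finset (Sites₀ t A)} {f g : EuclideanSpace ℝ (Fin 3) → EuclideanSpace ℝ (Fin 3)}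
    {u u' : EuclideanSpace ℝ (Fin 3) → EuclideanSpace ℝ (Fin 3)}
    (hu : Function.support u ⊆ Subtype.val '' (V : Set (Sites₀ t A)))
    (hu' : Function.support u' ⊆ Subtype.val '' (V : Set (Sites₀ t A)))
    (hru : ∀ p : Sites₀ t A, p ∈ V →
      ∑' q : Sites₀ t A, forceConst ((p : EuclideanSpace ℝ (Fin 3)) - q) (u p - u q) = f p)
    (hru' : ∀ p : Sites₀ t A, p ∈ V →
      ∑' q : Sites₀ t A, forceConst ((p : EuclideanSpace ℝ (Fin 3)) - q) (u' p - u' q) = g p)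
    (hfg : ∀ p : Sites₀ t A, p ∈ V → f p = g p) : u = u' :=
  galerkin_unique hA hI hκ hPS hu hu' hru (fun p hp => (hru' p hp).trans (hfg p hp).symm)

/-- The Galerkin solution of a sum is the sum of the Galerkin solutions. [folklore] -/
theorem galerkin_add (hA : Adm₀ A) (hI : Inner₀ t A) {κ : ℝ} (hκ : 0 < κ) (hPS : Blowdown.PSIneq κ t A)
    {V : Finset (Sites₀ t A)} {f g : EuclideanSpace ℝ (Fin 3) → EuclideanSpace ℝ (Fin 3)}
    {u v s : EuclideanSpace ℝ (Fin 3) → EuclideanSpace ℝ (Fin 3)}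
    (hu : Function.support u ⊆ Subtype.val '' (V : Set (Sites₀ t A)))
    (hv : Function.support v ⊆ Subtype.val '' (V : Set (Sites₀ t A)))
    (hs : Function.support s ⊆ Subtype.val '' (V : Set (Sites₀ t A)))
    (hru : ∀ p : Sites₀ t A, p ∈ V →
      ∑' q : Sites₀ t A, forceConst ((p : EuclideanSpace ℝ (Fin 3)) - q) (u p - u q) = f p)
    (hrv : ∀ p : Sites₀ t A, p ∈ V →
      ∑' q : Sites₀ t A, forceConst ((p : EuclideanSpace ℝ (Fin 3)) - q) (v p - v q) = g p)
    (hrs : ∀ p : Sites₀ t A, p ∈ V →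
      ∑' q : Sites₀ t A, forceConst ((p : EuclideanSpace ℝ (Fin 3)) - q) (s p - s q) = (f + g) p) :
    s = u + v := by
  refine galerkin_unique hA hI hκ hPS hs ?_ hrs ?_
  · intro x hx
    by_contra hx'
    have h1 : u x = 0 := by
      by_contra h
      exact hx' (hu h)
    have h2 : v x = 0 := by
      by_contra h
      exact hx' (hv h)
    exact hx (by simp [h1, h2])
  · intro p hp
    have := forceConst_row_add hA hI (finite_support_of_subset_image hu) (finite_support_of_subset_image hv) p
    simp only [Pi.add_apply]
    rw [this, hru p hp, hrv p hp]

/-- The Galerkin solution of a scalar multiple is the scalar multiple of the Galerkin solution. [folklore] -/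
theorem galerkin_smul (hA : Adm₀ A) (hI : Inner₀ t A) {κ : ℝ} (hκ : 0 < κ) (hPS : Blowdown.PSIneq κ t A)
    {V : Finset (Sites₀ t A)} {f : EuclideanSpace ℝ (Fin 3) → EuclideanSpace ℝ (Fin 3)} (c : ℝ)
    {u s : EuclideanSpace ℝ (Fin 3) → EuclideanSpace ℝ (Fin 3)}
    (hu : Function.support u ⊆ Subtype.val '' (V : Set (Sites₀ t A)))
    (hs : Function.support s ⊆ Subtype.val '' (V : Set (Sites₀ t A)))
    (hru : ∀ p : Sites₀ t A, p ∈ V →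
      ∑' q : Sites₀ t A, forceConst ((p : EuclideanSpace ℝ (Fin 3)) - q) (u p - u q) = f p)
    (hrs : ∀ p : Sites₀ t A, p ∈ V →
      ∑' q : Sites₀ t A, forceConst ((p : EuclideanSpace ℝ (Fin 3)) - q) (s p - s q) = (c • f) p) :
    s = c • u := by
  refine galerkin_unique hA hI hκ hPS hs ?_ hrs ?_
  · intro x hx
    by_contra hx'
    have h1 : u x = 0 := by
      by_contra h
      exact hx' (hu h)
    exact hx (by simp [h1])
  · intro p hp
    simp only [Pi.smul_apply]
    rw [forceConst_row_smul c u p, hru p hp]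

/-- The Galerkin solution of a right-hand side vanishing on `V` is zero. [folklore] -/
theorem galerkin_eq_zero (hA : Adm₀ A) (hI : Inner₀ t A) {κ : ℝ} (hκ : 0 < κ) (hPS : Blowdown.PSIneq κ t A)
    {V : Finset (Sites₀ t A)} {f : EuclideanSpace ℝ (Fin 3) → EuclideanSpace ℝ (Fin 3)}
    {u : EuclideanSpace ℝ (Fin 3) → EuclideanSpace ℝ (Fin 3)}
    (hu : Function.support u ⊆ Subtype.val '' (V : Set (Sites₀ t A)))
    (hru : ∀ p : Sites₀ t A, p ∈ V →
      ∑' q : Sites₀ t A, forceConst ((p : EuclideanSpace ℝ (Fin 3)) - q) (u p - u q) = f p)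
    (hf : ∀ p : Sites₀ t A, p ∈ V → f p = 0) : u = 0 := by
  refine galerkin_unique hA hI hκ hPS hu (by simp) hru ?_
  intro p hp
  simp [hf p hp]

end

/-- Registered helper of sub-goal `blowdown_greenSolve` (H2 of stub `stub_green`, crux stmt-AtomisticToContinuum-9332,
line `Sketch` v4): existence of the finite-level (Galerkin) solution of the force-constant operator on a finite set of
sites of an admissible hcp-like datum satisfying `PSIneq κ`. [folklore] -/
theorem blowdown_galerkin : ∀ (κ : ℝ) (t : Fin 2 → (EuclideanSpace ℝ (Fin 3))) (A : (EuclideanSpace ℝ (Fin 3)) →L[ℝ] (EuclideanSpace ℝ (Fin 3))), 0 < κ → Adm₀ A → Inner₀ t A → Blowdown.PSIneq κ t A → ∀ (V : Finset (Sites₀ t A)) (f : (EuclideanSpace ℝ (Fin 3)) → (EuclideanSpace ℝ (Fin 3))), ∃ u : (EuclideanSpace ℝ (Fin 3)) → (EuclideanSpace ℝ (Fin 3)), Function.support u ⊆ Subtype.val '' (V : Set (Sites₀ t A)) ∧ ∀ p : Sites₀ t A, p ∈ V → ∑' q : Sites₀ t A, forceConst ((p : (EuclideanSpace ℝ (Fin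 3))) - q) (u p - u q) = f p :=
  fun _ _ _ hκ hA hI hPS V f => exists_galerkin hA hI hκ hPS V f

end Summit.AtomisticToContinuum.Crystallization.Theorems.ExcessDecayLiouville

end
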